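import Summits.CriticalPhenomena.CardyFormulaZ2.Theorems.CardyIKTransportCornerLineDescentFreezeBlocks3
import Summits.CriticalPhenomena.CardyFormulaZ2.Theorems.CardyIKTransportCornerLineDescentFreezeRenewal2
import Summits.CriticalPhenomena.CardyFormulaZ2.Theorems.CardyIKTransportCornerLineDescentFreezeContinuity
import Summits.CriticalPhenomena.CardyFormulaZ2.Theorems.CardyIKTransportCornerLineDescentFreezeCoupling

/-!
# The frozen end `p = 0` of the corner line: the geometry of the coupling (rotation, reference points, displacement)

Support file for the registered stub `stub_FreezeHomogenisation` of the line `symmetric-seed-second-order` of the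
crux `CardyIKTransport.CornerLineDescent` (stmt-CriticalPhenomena-10964).  The deterministic geometry behind the
sandwich of the frozen-gauge crossing event:
* the eighth turn `e^{iπ/4}` (`rotEighth`) is an isometry; carriers, arcs, the collars `sideCollar` and the enlarged
  domain `enlarge` of the rotated rectangle `R.map rotEighth` are the rotated ones;
* the REFERENCE POINT `refT δ c (i, j) = δ (2i + (2j - 2c) i)` of a block, and THE NORMALISATION IDENTITY (anchor
  `rot_std_vertex_eq_refT`): `e^{iπ/4} · (2δ) · squareLatticeEmbedding.z (blkLat c b) = refT δ c b` on the class of `c`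
  (`√2 e^{iπ/4} = 1 + i`) — the rotated standard lattice at mesh `2δ` IS the lattice of reference points;
* DISPLACEMENT: a cell `y` is within `δ(|y0 - 2i| + |y1 - 2j| + 2)` of the reference point of a block `(i, j)`; on a
  good grid (`|2·flipCount m - m| ≤ θ M` on `[-M, M]`, block index = flip counts, `blockIdx_eq_flipCount`) this is
  `≤ δ(2θM + 2)` for the block of `y`, and the cells of a block with small index lie in the window
  (`abs_le_of_runIdx_eq`);
* colour = parity class of the black class `cls ω` (read on the bits at `0`), and gauge edges are short (`≤ √2`).
References: route file `Theses/CardyIKTransport.lean` (items 10964, 4967); Grimmett–Manolescu, PTRF 159 (2014) §2.1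
(`squareLatticeEmbedding`).
-/

noncomputable section

namespace Summit.CriticalPhenomena.CardyFormulaZ2.Theorems.CornerLineDescent.SymmetricSeed

open scoped BigOperators Topology Classical MeasureTheory ProbabilityTheory ENNReal NNReal
open Filter Set Function MeasureTheory
open Literature.Probability.Percolation (sitePercolation bondPercolation half BondConfig embDomainCrossing rectangle
  openGraph openGraph_adj openConnIn openCrossing)
open Literature.Probability.LatticeModels
open Literature.Probability.RandomPlanarGeometry

namespace Freeze

/-! ## The rotation `e^{iπ/4}` as an isometry; transport of carriers, arcs, collars -/

/-- The eighth turn is an isometry of the plane. [folklore] -/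
theorem isometry_rotEighth : Isometry rotEighth := by
  refine Isometry.of_dist_eq fun x y => ?_
  rw [Homeomorph.coe_mulLeft₀, Complex.dist_eq, Complex.dist_eq, ← mul_sub, norm_mul]
  change ‖eighthTurn‖ * ‖x - y‖ = ‖x - y‖
  rw [norm_eighthTurn, one_mul]

/-- The eighth turn as an isometric equivalence. [folklore] -/
def rotIso : ℂ ≃ᵢ ℂ := ⟨rotEighth.toEquiv, isometry_rotEighth⟩

/-- `rotIso` acts as the eighth turn. [folklore] -/
@[simp] theorem rotIso_apply (p : ℂ) : rotIso p = rotEighth p := rfl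

/-- The eighth turn preserves norms. [folklore] -/
theorem norm_rotEighth (p : ℂ) : ‖rotEighth p‖ = ‖p‖ := by
  rw [Homeomorph.coe_mulLeft₀]
  change ‖eighthTurn * p‖ = ‖p‖
  rw [norm_mul, norm_eighthTurn, one_mul]

/-- `infDist` is invariant under the eighth turn. [folklore] -/
theorem infDist_rot (p : ℂ) (S : Set ℂ) : Metric.infDist (rotEighth p) (rotEighth '' S) = Metric.infDist p S :=
  Metric.infDist_image isometry_rotEighth

/-- Images of closed balls. [folklore] -/
theorem rot_image_closedBall (q : ℂ) (r : ℝ) : rotEighth '' Metric.closedBall q r = Metric.closedBall (rotEighth q) r :=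
  rotIso.image_closedBall q r

/-- The other arcs of the rotated rectangle. [folklore] -/
theorem otherArcs_map (R : ConformalRectangle) (i : Fin 4) :
    otherArcs (R.map rotEighth) i = rotEighth '' otherArcs R i := by
  simp only [otherArcs, Set.image_iUnion, MarkedDomain.arc_map]

/-- The collars of the rotated rectangle are the rotated collars. [folklore] -/
theorem sideCollar_map (R : ConformalRectangle) (i : Fin 4) (κ : ℝ) :
    sideCollar (R.map rotEighth) i κ = rotEighth '' sideCollar R i κ := by
  ext p
  obtain ⟨q, rfl⟩ := rotEighth.surjective p
  rw [rotEighth.injective.mem_set_image]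
  simp only [sideCollar, Set.mem_setOf_eq, MarkedDomain.arc_map, otherArcs_map, infDist_rot]

/-- The enlarged domain of the rotated rectangle is the rotated enlarged domain. [folklore] -/
theorem enlarge_map (R : ConformalRectangle) (κ : ℝ) :
    enlarge (R.map rotEighth) κ = rotEighth '' enlarge R κ := by
  simp only [enlarge, Set.image_union, sideCollar_map, MarkedDomain.carrier_map]

/-! ## The reference point of a block and the displacement of its cells on the good-grid event -/

/-- The cell embedding of the vocabulary: `v ↦ v0 + i v1`. [folklore] -/
def cellPos (v : Site 2) : ℂ := ((v 0 : ℝ) : ℂ) + ((v 1 : ℝ) : ℂ) * Complex.I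

/-- THE REFERENCE POINT of the block `b = (i, j)` at mesh `δ`, in the frame of the gauge: `δ (2i + (2j - 2c) i)`. [folklore] -/
def refT (δ : ℝ) (c : ℤ) (b : ℤ × ℤ) : ℂ := (δ : ℂ) * (((2 * b.1 : ℤ) : ℂ) + ((2 * b.2 - 2 * c : ℤ) : ℂ) * Complex.I)

/-- THE NORMALISATION IDENTITY: the rotated standard vertex `e^{iπ/4} · (2δ) · squareLatticeEmbedding.z (blkLat b)`
IS the reference point of the block `b` (for `b` in the parity class of `c`): `√2 e^{iπ/4} = 1 + i`. [folklore] -/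
theorem rot_z_blkLat {c : ℤ} {b : ℤ × ℤ} (h : Even (b.1 + b.2 - c)) (δ : ℝ) :
    rotEighth ((((2 * δ : ℝ)) : ℂ) * squareLatticeEmbedding.z (blkLat c b)) = refT δ c b := by
  obtain ⟨k, hk⟩ := h
  rw [Homeomorph.coe_mulLeft₀, squareLatticeEmbedding_z]
  change eighthTurn * (((2 * δ : ℝ) : ℂ) * ((Real.sqrt 2 : ℂ) * Site.toComplex (blkLat c b))) = refT δ c b
  have h1 : eighthTurn * (((2 * δ : ℝ) : ℂ) * ((Real.sqrt 2 : ℂ) * Site.toComplex (blkLat c b))) =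
      ((2 * δ : ℝ) : ℂ) * (((Real.sqrt 2 : ℂ) * eighthTurn) * Site.toComplex (blkLat c b)) := by ring
  rw [h1, sqrt_two_mul_eighthTurn]
  have hb0 : (blkLat c b 0 : ℤ) = k := by simp; omega
  have hb1 : (blkLat c b 1 : ℤ) = k - b.1 := by simp; omega
  have hb2 : b.2 = 2 * k - b.1 + c := by omega
  obtain ⟨b1, b2⟩ := b
  simp only at hb2
  subst hb2
  apply Complex.ext
  · simp [refT, Site.toComplex, hb0, hb1]; ring
  · simp [refT, Site.toComplex, hb0, hb1]; ring

/-- The reference point of the block of a lattice vertex. [folklore] -/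
theorem refT_latBlk (δ : ℝ) (c : ℤ) (x : Site 2) :
    refT δ c (latBlk c x) = rotEighth ((((2 * δ : ℝ)) : ℂ) * squareLatticeEmbedding.z x) := by
  rw [← rot_z_blkLat (even_latBlk c x), blkLat_latBlk]

/-- DISPLACEMENT OF A CELL FROM THE REFERENCE POINT OF ITS BLOCK: `δ (|y0 - 2i| + |y1 - 2j| + 2)` (`c ∈ {0,1}`). [folklore] -/
theorem dist_cellPos_refT_le (δ : ℝ) (hδ : 0 ≤ δ) {c : ℤ} (hc : c = 0 ∨ c = 1) (b : ℤ × ℤ) (y : Site 2) :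
    dist ((δ : ℂ) * cellPos y) (refT δ c b) ≤ δ * (|(y 0 : ℝ) - 2 * b.1| + |(y 1 : ℝ) - 2 * b.2| + 2) := by
  rw [Complex.dist_eq, refT, cellPos, ← mul_sub, norm_mul, Complex.norm_real, Real.norm_eq_abs, abs_of_nonneg hδ]
  refine mul_le_mul_of_nonneg_left ?_ hδ
  refine (Complex.norm_le_abs_re_add_abs_im _).trans ?_
  have h2 : |(2 * (c : ℝ))| ≤ 2 := by rcases hc with rfl | rfl <;> simp
  simp only [Complex.sub_re, Complex.add_re, Complex.ofReal_re, Complex.mul_re, Complex.I_re, mul_zero,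
    Complex.ofReal_im, Complex.I_im, mul_one, sub_self, add_zero, Complex.intCast_re, Complex.intCast_im,
    Complex.sub_im, Complex.add_im, Complex.mul_im, zero_add]
  push_cast
  have := abs_sub (((y 1 : ℝ)) - 2 * b.2) (-(2 * (c : ℝ)))
  rw [abs_neg] at this
  have e1 : (y 1 : ℝ) - (2 * ↑b.2 - 2 * ↑c) = (y 1 : ℝ) - 2 * b.2 - -(2 * (c : ℝ)) := by ring
  rw [e1]
  linarith

/-! ## The good grid: flip enumerations, block indices as flip counts, colours as a parity class -/

/-- THE BLACK CLASS of the frozen configuration: black blocks are those with `i + j ≡ cls ω (mod 2)`. [folklore] -/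
def cls (ω : Bits) : ℤ := if Xor ((0 : ℤ) ∈ ω.1) ((0 : ℤ) ∈ ω.2.1) then 0 else 1

/-- The black class is `0` or `1`. [folklore] -/
theorem cls_eq (ω : Bits) : cls ω = 0 ∨ cls ω = 1 := by
  unfold cls; split_ifs <;> simp

variable {ω : Bits}

/-- On the normalised enumeration the bit at `0` is the bit of run `0`. [folklore] -/
theorem FlipEnum.mem_zero_iff {A : Set ℤ} (e : FlipEnum A) (h0 : e.pos 0 ≤ 0 ∧ 0 < e.pos 1) :
    ((0 : ℤ) ∈ A ↔ e.pos 0 ∈ A) := by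
  have hr : e.runIdx 0 = 0 := e.runIdx_eq_iff.2 ⟨h0.1, by simpa using h0.2⟩
  have := e.mem_iff_pos_runIdx_mem 0
  rwa [hr] at this

/-- COLOUR = PARITY CLASS: with no syndromes and normalised enumerations, the cell `y` is black iff its block lies in
the class of `cls ω`. [folklore] -/
theorem gaugeColour_iff_even_cls (h : ω.2.2.1 = ∅) (eA : FlipEnum ω.1) (eB : FlipEnum ω.2.1)
    (hA0 : eA.pos 0 ≤ 0 ∧ 0 < eA.pos 1) (hB0 : eB.pos 0 ≤ 0 ∧ 0 < eB.pos 1) (y : Site 2) :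
    gaugeColour ω y ↔ Even ((blockIdx eA eB y).1 + (blockIdx eA eB y).2 - cls ω) := by
  rw [gaugeColour_iff_blockParity h eA eB, ← eA.mem_zero_iff hA0, ← eB.mem_zero_iff hB0]
  unfold cls
  split_ifs with hx
  · simp only [Xor, ← Int.not_even_iff_odd, sub_zero] at hx ⊢; tauto
  · simp only [Xor, ← Int.not_even_iff_odd, Int.even_sub_one] at hx ⊢; tauto

/-- BLOCK INDEX = FLIP COUNTS on normalised enumerations. [folklore] -/
theorem blockIdx_eq_flipCount (eA : FlipEnum ω.1) (eB : FlipEnum ω.2.1)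
    (hA0 : eA.pos 0 ≤ 0 ∧ 0 < eA.pos 1) (hB0 : eB.pos 0 ≤ 0 ∧ 0 < eB.pos 1) (y : Site 2) :
    blockIdx eA eB y = (flipCount ω.1 (y 0), flipCount ω.2.1 (y 1)) := by
  simp only [blockIdx, eA.runIdx_eq_flipCount hA0, eB.runIdx_eq_flipCount hB0]

/-- CELLS OF A SMALL BLOCK LIE IN THE WINDOW: if `|2·flipCount m - m| ≤ θ M` for `|m| ≤ M`, then every cell of a run
`i` with `2|i| < M - θ M` lies in `[-M, M]` (the run index is monotone and already too large at `±M`). [folklore] -/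
theorem abs_le_of_runIdx_eq {A : Set ℤ} (e : FlipEnum A) (h0 : e.pos 0 ≤ 0 ∧ 0 < e.pos 1) {M : ℕ} {θ : ℝ}
    (hd : ∀ m : ℤ, |m| ≤ M → |2 * (flipCount A m : ℝ) - m| ≤ θ * M) {i : ℤ} (hi : 2 * |(i : ℝ)| < M - θ * M)
    {z : ℤ} (hz : e.runIdx z = i) : |z| ≤ M := by
  by_contra hzM
  push Not at hzM
  have hM := hd M (by simp)
  have hM' := hd (-(M : ℤ)) (by simp)
  rw [← e.runIdx_eq_flipCount h0] at hM hM'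
  have habs : (i : ℝ) ≤ |(i : ℝ)| := le_abs_self _
  have habs' : -|(i : ℝ)| ≤ i := neg_abs_le _
  rcases le_or_gt 0 z with hz0 | hz0
  · have hzM' : (M : ℤ) < z := by rwa [abs_of_nonneg hz0] at hzM
    have h1 : e.runIdx (M : ℤ) ≤ e.runIdx z := e.runIdx_mono hzM'.le
    rw [hz] at h1
    have h1' : ((e.runIdx (M : ℤ) : ℤ) : ℝ) ≤ i := by exact_mod_cast h1
    have h2 := (abs_le.1 hM).1
    push_cast at h2
    linarith
  · have hzM' : z < -(M : ℤ) := by rw [abs_of_neg hz0] at hzM; omega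
    have h1 : e.runIdx z ≤ e.runIdx (-(M : ℤ)) := e.runIdx_mono hzM'.le
    rw [hz] at h1
    have h1' : (i : ℝ) ≤ ((e.runIdx (-(M : ℤ)) : ℤ) : ℝ) := by exact_mod_cast h1
    have h2 := (abs_le.1 hM').2
    push_cast at h2
    linarith

/-! ## Edges of the gauge are short -/

/-- `cellPos` is additive. [folklore] -/
theorem cellPos_add (u w : Site 2) : cellPos (u + w) = cellPos u + cellPos w := by
  simp only [cellPos, Pi.add_apply, Int.cast_add, Complex.ofReal_add]; ring

/-- The norm of a cell vector. [folklore] -/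
theorem norm_cellPos (w : Site 2) : ‖cellPos w‖ = Real.sqrt ((w 0 : ℝ) ^ 2 + (w 1 : ℝ) ^ 2) := by
  rw [Complex.norm_def, Complex.normSq_apply]
  congr 1
  simp [cellPos]; ring

/-- The length of a step `u → u + w`. [folklore] -/
theorem dist_cellPos_add (u w : Site 2) : dist (cellPos u) (cellPos (u + w)) = Real.sqrt ((w 0 : ℝ) ^ 2 + (w 1 : ℝ) ^ 2) := by
  rw [dist_comm, Complex.dist_eq, cellPos_add, add_sub_cancel_left, norm_cellPos]

/-- A gauge edge joins cells at Euclidean distance `≤ √2`. [folklore] -/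
theorem dist_cellPos_le_of_mem_gaugeEdges {ω : Bits} {x y : Site 2} (h : s(x, y) ∈ gaugeEdges ω) :
    dist (cellPos x) (cellPos y) ≤ Real.sqrt 2 := by
  have key : ∀ {u v : Site 2}, Step ω u v → dist (cellPos u) (cellPos v) ≤ Real.sqrt 2 := by
    intro u v hst
    rcases hst with rfl | rfl | ⟨rfl, -⟩ | ⟨rfl, -⟩ <;> rw [dist_cellPos_add] <;>
      refine Real.sqrt_le_sqrt ?_ <;> simp <;> norm_num
  rcases (mem_gaugeEdges_iff ω x y).1 h with ⟨-, -, hst⟩ | ⟨-, -, hst⟩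
  · exact key hst
  · rw [dist_comm]; exact key hst

end Freeze

/-- ANCHOR (registered sub-goal). THE NORMALISATION IDENTITY OF THE FROZEN END: for a block `b = (i, j)` of the parity
class of `c`, the rotated standard-lattice vertex `e^{iπ/4} · (2δ) · squareLatticeEmbedding.z (blkLat c b)` equals the
reference point `δ (2i + (2j - 2c) i)` of the block (`√2 · e^{iπ/4} = 1 + i`). [folklore] -/
theorem rot_std_vertex_eq_refT : ∀ (c : ℤ) (b : ℤ × ℤ), Even (b.1 + b.2 - c) → ∀ (δ : ℝ), Freeze.rotEighth ((((2 * δ : ℝ)) : ℂ) * squareLatticeEmbedding.z (Freeze.blkLat c b)) = Freeze.refT δ c b :=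
  fun _ _ h δ => Freeze.rot_z_blkLat h δ

end Summit.CriticalPhenomena.CardyFormulaZ2.Theorems.CornerLineDescent.SymmetricSeed
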